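import Literature.Analysis.FluidPDE.FluidComputer.ThresholdLevelTableLRun0
import Literature.Analysis.FluidPDE.FluidComputer.ThresholdLevelTableLRun1
import Literature.Analysis.FluidPDE.FluidComputer.ThresholdLevelTableLRun2
import Literature.Analysis.FluidPDE.FluidComputer.ThresholdLevelTableLRun3
import Literature.Analysis.FluidPDE.FluidComputer.ThresholdLevelTableLRun4
import Literature.Analysis.FluidPDE.FluidComputer.ThresholdLevelTableLRun5
import Literature.Analysis.FluidPDE.FluidComputer.ThresholdLevelTableLRun6
import Literature.Analysis.FluidPDE.FluidComputer.ThresholdLevelTableLRun7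
import Literature.Analysis.FluidPDE.FluidComputer.ThresholdLevelTableLRun8
import Literature.Analysis.FluidPDE.FluidComputer.ThresholdLevelTableLRun9
import Literature.Analysis.FluidPDE.FluidComputer.ThresholdLevelTableLRun10
import Literature.Analysis.FluidPDE.FluidComputer.ThresholdLevelTableLRun11
import Literature.Analysis.FluidPDE.FluidComputer.ThresholdLevelTableLRun12
import Literature.Analysis.FluidPDE.FluidComputer.ThresholdLevelTableLRun13
import Literature.Analysis.FluidPDE.FluidComputer.ThresholdLevelCertificate
import HarnessLib

/-!
# Certificate: the RE-CUT transfer stage of the threshold gate, from the tube's hand-off box (bp3 gen 13)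

HONEST FRAMING: low prior, high value-of-information experiment on Tao's machine paradigm; NOT a
claim that NS blows up.

THE STAGE-3 HALF OF THE FIRST FULL-CYCLE CERTIFICATE.  Same checker, same soundness theorem, same proof as
`ThresholdLevelCertificate.lean` (the A = 2 design point: `ε = 3602879701896397/2^54 = 0.2`,
`σ = 6599717126571359/2^64 ≈ 3.58·10⁻⁴`, `ν = 480`, `μ = 96`, `r = 3231890945169777/2^38 ≈ 1.18·10⁴`,
`κ = 4800`, forcing defect `δ = 2111909480502835/2^69 ≈ 3.58·10⁻⁶`, mode-ball radius `Rbt ≈ 1.0300` — the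
data `Gt`, `GIt`, `RbIt` are REUSED from there), but on the RE-CUT table `ThresholdLevelTableL`: the stage
starts at the tube's read-out level `C₋ = 117685124146233/2^60 ≈ 0.00010208` (a quarter of the design
level `C₀`) from the HAND-OFF BOX of the kernel-certified stage-1–2 tube (`TubeTable.HT` read as a level
entry box: carrier `a ∈ [0.976271, 0.976563]`, clock `b ∈ [0.212458, 0.213048]`, slaving
residual `w ∈ [-0.13689, 0.05991]`, output `ã ∈ [0.035239, 0.036849]`, energy
`E ∈ [0.9999401, 1.0000599]`) — a box some 5–300 times WIDER per coordinate than the design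
table's `Aint` (which δ-forced orbits from the gate's input box provably miss: b by 1.6, ã by 5 half-widths)
— and runs through 1400 levels in time `T₃L = 383079277262628088/2^60 ≈ 0.33227`: every `δ`-approximate orbit
started in that box has LOADED THE OUTPUT MODE, `x s 4 ^ 2 ≥ EoutL ≈ 0.92240`, at some `s ∈ [0, T₃L]`
(`recut_transfer_reach`) — at least `92.23 %` of the entry energy (design entry: `92.48 %`; exact twin from
this box: `92.24 %`).  The price of the honest (forced, box-valued) hand-off is thus ≈ 0.3 % of transfer.

PROOF.  `ThresholdLevelTableLRun0 … 13` kernel-evaluate `runSteps` on the 56 chunks (`run0 … run55`),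
`runSteps_append_some` chains them (`run_allL`), `TableD.rowsValid_of_runSteps` gives `LevelTable.RowsValid`
for the real table `LtL`, and `levelTableStage_reach` discharges the rows.  Side facts: the cap sum (`decide +kernel` inside `LtL_time`),
energy margin (`norm_num`); `pEntryL_mem` exhibits an explicit state of the entry box (non-vacuity).
Sorry-free; standard axioms only.

WHAT THIS IS NOT.  One stage of one gate of the `5`-mode truncated circuit with an abstract forcing defect;
composed with the tube in `TubeCertificate.lean`; not the drain stage, not the gate verdict, not a statement
about the averaged or the true Navier–Stokes equations, not evidence for blow-up.
-/

noncomputable section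

open Set

namespace Literature.Analysis.FluidPDE.FluidComputer

open Literature.Analysis.FluidPDE.Tao2016AveragedNS

namespace ThresholdLevelTableL

open ThresholdLevelTable (GIt RbIt Gt Gt_valid GIt_mem Rbt RbIt_mem sum_range_getD_h)

/-- The whole re-cut table run: all 1400 steps pass and generate the final entry box `Bc56`.
[folklore] -/
theorem run_allL : runSteps 60 12 3 GIt RbIt Bc0 stepsT CNt = some Bc56 :=
  runSteps_append_some 60 12 3 GIt RbIt run0
    (runSteps_append_some 60 12 3 GIt RbIt run1
    (runSteps_append_some 60 12 3 GIt RbIt run2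
    (runSteps_append_some 60 12 3 GIt RbIt run3
    (runSteps_append_some 60 12 3 GIt RbIt run4
    (runSteps_append_some 60 12 3 GIt RbIt run5
    (runSteps_append_some 60 12 3 GIt RbIt run6
    (runSteps_append_some 60 12 3 GIt RbIt run7
    (runSteps_append_some 60 12 3 GIt RbIt run8
    (runSteps_append_some 60 12 3 GIt RbIt run9
    (runSteps_append_some 60 12 3 GIt RbIt run10
    (runSteps_append_some 60 12 3 GIt RbIt run11
    (runSteps_append_some 60 12 3 GIt RbIt run12
    (runSteps_append_some 60 12 3 GIt RbIt run13
    (runSteps_append_some 60 12 3 GIt RbIt run14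
    (runSteps_append_some 60 12 3 GIt RbIt run15
    (runSteps_append_some 60 12 3 GIt RbIt run16
    (runSteps_append_some 60 12 3 GIt RbIt run17
    (runSteps_append_some 60 12 3 GIt RbIt run18
    (runSteps_append_some 60 12 3 GIt RbIt run19
    (runSteps_append_some 60 12 3 GIt RbIt run20
    (runSteps_append_some 60 12 3 GIt RbIt run21
    (runSteps_append_some 60 12 3 GIt RbIt run22
    (runSteps_append_some 60 12 3 GIt RbIt run23
    (runSteps_append_some 60 12 3 GIt RbIt run24
    (runSteps_append_some 60 12 3 GIt RbIt run25
    (runSteps_append_some 60 12 3 GIt RbIt run26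
    (runSteps_append_some 60 12 3 GIt RbIt run27
    (runSteps_append_some 60 12 3 GIt RbIt run28
    (runSteps_append_some 60 12 3 GIt RbIt run29
    (runSteps_append_some 60 12 3 GIt RbIt run30
    (runSteps_append_some 60 12 3 GIt RbIt run31
    (runSteps_append_some 60 12 3 GIt RbIt run32
    (runSteps_append_some 60 12 3 GIt RbIt run33
    (runSteps_append_some 60 12 3 GIt RbIt run34
    (runSteps_append_some 60 12 3 GIt RbIt run35
    (runSteps_append_some 60 12 3 GIt RbIt run36
    (runSteps_append_some 60 12 3 GIt RbIt run37
    (runSteps_append_some 60 12 3 GIt RbIt run38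
    (runSteps_append_some 60 12 3 GIt RbIt run39
    (runSteps_append_some 60 12 3 GIt RbIt run40
    (runSteps_append_some 60 12 3 GIt RbIt run41
    (runSteps_append_some 60 12 3 GIt RbIt run42
    (runSteps_append_some 60 12 3 GIt RbIt run43
    (runSteps_append_some 60 12 3 GIt RbIt run44
    (runSteps_append_some 60 12 3 GIt RbIt run45
    (runSteps_append_some 60 12 3 GIt RbIt run46
    (runSteps_append_some 60 12 3 GIt RbIt run47
    (runSteps_append_some 60 12 3 GIt RbIt run48
    (runSteps_append_some 60 12 3 GIt RbIt run49
    (runSteps_append_some 60 12 3 GIt RbIt run50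
    (runSteps_append_some 60 12 3 GIt RbIt run51
    (runSteps_append_some 60 12 3 GIt RbIt run52
    (runSteps_append_some 60 12 3 GIt RbIt run53
    (runSteps_append_some 60 12 3 GIt RbIt run54
    run55))))))))))))))))))))))))))))))))))))))))))))))))))))))

/-- The stage time budget `T₃L = Σ h k`. [folklore] -/
def T₃L : ℝ := (383079277262628088 : ℝ) / 2 ^ 60

/-- The certified output load `EoutL = (zℓ at level 1400)² ≈ 0.92240`. [folklore] -/
def EoutL : ℝ := ((1107287250866228930 : ℝ) / 2 ^ 60) ^ 2

/-- The real re-cut level table. [folklore] -/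
def LtL : LevelTable := tableT.toTable 60 12 3 GIt RbIt

/-- The rows of `LtL` are valid (from the kernel run) and the final entry box is `Bc56`.
[folklore] -/
theorem LtL_rowsValid :
    LtL.RowsValid Gt Rbt ∧ tableT.entry 60 12 3 GIt RbIt tableT.steps.length = Bc56 :=
  TableD.rowsValid_of_runSteps (by norm_num) GIt_mem RbIt_mem tableT run_allL

/-- The caps of `LtL` sum to `T₃L`. [folklore] -/
theorem LtL_time : ∑ k ∈ Finset.range LtL.N, LtL.h k = T₃L := by
  show ∑ k ∈ Finset.range stepsT.length, (((stepsT.getD k ⟨CNt, 0⟩).h : ℝ) / 2 ^ 60) = T₃L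
  have hsum : (ThresholdLevelTableL.stepsT.map StepD.h).sum = ThresholdLevelTableL.HsumT := by
    decide +kernel
  rw [sum_range_getD_h, hsum]
  norm_num [T₃L, HsumT]

/-- The level-`0` entry box of `LtL` is `Bc0` read at scale `2^60`. [folklore] -/
theorem LtL_B_zero : LtL.B 0 = Bc0.toReal 60 := rfl

/-- The level-`0` trigger level is the tube's read-out level `C₋`. [folklore] -/
theorem LtL_C_zero : LtL.C 0 = ((117685124146233 : ℤ) : ℝ) / 2 ^ 60 := rfl

/-- Energy confinement margin: entry energy plus forcing work stays inside the mode ball.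
[folklore] -/
theorem LtL_energy : ∀ q ∈ {q | (LtL.B 0).mem Gt.κ Gt.r (LtL.C 0) q},
    energy q + 10 * (Gt.δ * Rbt) * T₃L < Rbt ^ 2 := by
  intro q hq
  have hEh : energy q ≤ ((1152990529000121906 : ℤ) : ℝ) / 2 ^ 60 := hq.2.2.2.2.2.2
  have hnum : ((1152990529000121906 : ℤ) : ℝ) / 2 ^ 60 + 10 * (Gt.δ * Rbt) * T₃L < Rbt ^ 2 := by
    norm_num [Gt, Rbt, T₃L]
  linarith

/-- The final entry box certifies the output load. [folklore] -/
theorem LtL_exit : ∀ X, (LtL.B LtL.N).mem Gt.κ Gt.r (LtL.C LtL.N) X → EoutL ≤ X 4 ^ 2 := by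
  intro X hX
  have hB : LtL.B LtL.N = Bc56.toReal 60 := by
    show (tableT.entry 60 12 3 GIt RbIt tableT.steps.length).toReal 60 = _
    rw [LtL_rowsValid.2]
  rw [hB] at hX
  have hz : ((1107287250866228930 : ℤ) : ℝ) / 2 ^ 60 ≤ X 4 := hX.2.2.2.2.1.1
  have h0 : (0 : ℝ) ≤ ((1107287250866228930 : ℤ) : ℝ) / 2 ^ 60 := by positivity
  calc EoutL = (((1107287250866228930 : ℤ) : ℝ) / 2 ^ 60) ^ 2 := by norm_num [EoutL]
    _ ≤ X 4 ^ 2 := pow_le_pow_left₀ h0 hz 2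

/-- The level-`0` entry set of the re-cut certificate (= the tube's hand-off box). [folklore] -/
def AintL : Set (Fin 5 → ℝ) := {q | (LtL.B 0).mem Gt.κ Gt.r (LtL.C 0) q}

/-- THE RE-CUT STAGE-3 REACH CERTIFICATE: from `AintL`, inside the mode ball of radius `Rbt`, with forcing
defect `Gt.δ`, within time `T₃L`, the circuit reaches `outputLoaded EoutL`. [folklore] -/
def recut_transferStage :
    ReachCertificate (thresholdCircuit Gt.ε Gt.σ Gt.ν Gt.μ Gt.r Gt.κ) (modeBall Rbt) Gt.δ T₃L AintL
      (outputLoaded EoutL) :=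
  levelTableStage Gt Gt_valid Rbt T₃L EoutL LtL AintL (by norm_num [Rbt]) LtL_rowsValid.1 LtL_time.le
    LtL_energy (fun _ hq => hq) LtL_exit

/-- THE RE-CUT CERTIFICATE.  Every `δ`-approximate orbit of the threshold circuit started in the tube's
hand-off box at level `C₋` loads the output mode to `x s 4 ^ 2 ≥ EoutL ≈ 0.92240` at some time
`s ≤ T₃L ≈ 0.33227`.  [cite: Tao2016AveragedNS, §5.5 Thm 5.3 (5.5)] -/
theorem recut_transfer_reach {p : Fin 5 → ℝ} (hp : (LtL.B 0).mem Gt.κ Gt.r (LtL.C 0) p)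
    {x : ℝ → Fin 5 → ℝ} (hx0 : x 0 = p) (hcont : ContinuousOn x (Icc 0 T₃L))
    (hder : ∀ s ∈ Ico 0 T₃L, ∃ W : Fin 5 → ℝ, HasDerivWithinAt x W (Ici s) s ∧
      ‖W - thresholdCircuit Gt.ε Gt.σ Gt.ν Gt.μ Gt.r Gt.κ (x s)‖ ≤ Gt.δ) :
    ∃ s ∈ Icc 0 T₃L, EoutL ≤ x s 4 ^ 2 :=
  levelTableStage_reach Gt Gt_valid Rbt T₃L EoutL LtL AintL (by norm_num [Rbt]) LtL_rowsValid.1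
    LtL_time.le (by norm_num [T₃L]) LtL_energy (fun _ hq => hq) LtL_exit hp hx0 hcont hder

/-- An explicit state in the hand-off box (non-vacuity witness). [folklore] -/
def pEntryL : Fin 5 → ℝ :=
  ![976419 / 1000000, 212753 / 1000000, (117685124146233 : ℝ) / 2 ^ 60, 16377 / 2500000, 9011 / 250000]

/-- `pEntryL` lies in the level-`0` entry box. [folklore] -/
theorem pEntryL_mem : (LtL.B 0).mem Gt.κ Gt.r (LtL.C 0) pEntryL := by
  rw [LtL_B_zero, LtL_C_zero]
  refine ⟨⟨?_, ?_⟩, ⟨?_, ?_⟩, ?_, ⟨?_, ?_⟩, ⟨?_, ?_⟩, ⟨?_, ?_⟩⟩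
  all_goals
    simp only [LevelEntryD.toReal, Bc0, pEntryL, Gt, slavingResidual, Ignition.energy_five, Fin.isValue,
      Matrix.cons_val_zero, Matrix.cons_val_one, Matrix.cons_val]
  all_goals norm_num

/-- Hence the entry set of the re-cut certificate is nonempty. [folklore] -/
theorem AintL_nonempty : AintL.Nonempty := ⟨pEntryL, pEntryL_mem⟩

end ThresholdLevelTableL

end Literature.Analysis.FluidPDE.FluidComputer

end
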